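import Mathlib.Analysis.Calculus.Deriv.MeanValue
import Mathlib.Analysis.Calculus.ContDiff.Deriv
import Mathlib.Analysis.Calculus.Deriv.Inv
import Summits.FinalStateConjecture.FinalStateConjecture.Statement
import HarnessLib

/-!
# Exit lemma for weighted null-concave crush functions (crux `SettledCapture`,
# stmt-FinalStateConjecture-17328, card `null-concave-crush`, first lemma)

A by-product of the line-lead seat `prover-line-stmt-FinalStateConjecture-17328-c1-0` for the crux
`Summit.FinalStateConjecture.FinalStateConjecture.Theses.BartnikGapSettling.SettledCapture`
(route `BartnikGapSettling`, rank 4): the FIRST LEMMA of the crux idea card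
`Cruxes/SettledCapture/Ideas/null-concave-crush.md` (ideator 2, round 1; statement =
`Cruxes/SettledCapture/SketchIdeator2.lean`, `exit_of_weightedConcave`, there with `sorry`), which
is the real-analysis half of the card's route to the T2 rays clause `RaysStayInClosure 𝒟 O`
("no future-complete normalised null ray from `Σ` ever enters the black-hole region `B`"); the
GR half is the card's `KerrCrushCertificate`. Like `stub_visibleRaysStay`
(`BartnikGapSettlingSettledCaptureStubVisibleRaysStay.lean`) it never mentions the crux's leaf
block, so it transfers verbatim to any re-typing of the crux.

**Statement.** Let `B ⊆ 𝒟` future-absorb normalised null rays from `Σ` (`habs`) and let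
`f > 0` on `B` be a WEIGHTED NULL-CONCAVE CRUSH FUNCTION along rays in `B` (`hcrush`): on every
compact parameter segment `[t₁, t₂] ⊆ dom` mapped into `B`, `h = f ∘ γ` is `C²`, and on the open
segment `h' < 0` and `h · h'' ≤ ρ · h'²` with one constant `ρ < 1`. Then no ray whose parameter
domain is an interval unbounded above (future-complete) has a point in `B`.

**Proof** (Riccati comparison). If `γ t ∈ B` with `dom ⊇ [t, ∞)`, then `h > 0`, `h' < 0` on
`(t, ∞)` and `y := h / h'` is negative there with `y' = (h'² − h h'')/h'² ≥ 1 − ρ > 0`; by the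
mean value inequality (`Convex.mul_sub_le_image_sub_of_le_deriv`) `y` gains at least
`(1 − ρ) · L` over a parameter length `L`, so it becomes positive — contradiction. (Equivalently
`(h^{1−ρ})'' ≤ 0`, so the positive decreasing concave function `h^{1−ρ}` vanishes within
parameter `h₀ / ((1 − ρ)|h₀'|)`; the card's form.) Elementary real analysis; the ray predicate
`IsNormalisedNullRayFrom` is used only as an opaque label shared by the hypotheses and the
conclusion.

References: none needed — folklore ODE comparison (a Riccati inequality `z' ≤ −(1 − ρ) z²` for
`z = h'/h < 0` blows down in finite parameter); the card `null-concave-crush` supplies the GR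
context (Kerr region II certificate, kit job j023930) which is NOT used here.
-/

-- the doubled `FinalStateConjecture` path component is the summit/problem naming scheme
set_option linter.dupNamespace false

noncomputable section

namespace Summit.FinalStateConjecture.FinalStateConjecture.Theorems.BartnikGapSettling.SettledCapture

open Set Filter Topology
open scoped Manifold ContDiff ENNReal
open Literature.Geometry.Lorentzian

/-- **Real-analysis core of the exit lemma.** There is no function `h : ℝ → ℝ` which, to the
right of `t`, is positive, `C²` on every `[t, T]`, strictly decreasing (`h' < 0`) and weighted
concave (`h · h'' ≤ ρ · h'²`) with a weight `ρ < 1`: the quotient `y = h / h'` is negative but has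
`y' ≥ 1 − ρ > 0`, so it would become positive after parameter length `(1 − y(t+1))/(1 − ρ)`.
[folklore] -/
theorem false_of_pos_of_deriv_neg_of_weightedConcave {h : ℝ → ℝ} {t ρ : ℝ} (hρ : ρ < 1)
    (hpos : ∀ τ, t < τ → 0 < h τ)
    (hC2 : ∀ T, t < T → ContDiffOn ℝ 2 h (Icc t T))
    (hder : ∀ τ, t < τ → deriv h τ < 0 ∧ h τ * deriv (deriv h) τ ≤ ρ * deriv h τ ^ 2) :
    False := by
  have h1ρ : 0 < 1 - ρ := sub_pos.2 hρ
  -- `h` and `h'` are differentiable at every `τ > t`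
  have hdiff : ∀ τ, t < τ → DifferentiableAt ℝ h τ ∧ DifferentiableAt ℝ (deriv h) τ := by
    intro τ hτ
    have hS : ContDiffOn ℝ 2 h (Ioo t (τ + 1)) :=
      (hC2 (τ + 1) (by linarith)).mono Ioo_subset_Icc_self
    have hmem : Ioo t (τ + 1) ∈ 𝓝 τ := isOpen_Ioo.mem_nhds ⟨hτ, lt_add_one τ⟩
    refine ⟨(hS.differentiableOn (by simp)).differentiableAt hmem, ?_⟩
    have hS' : ContDiffOn ℝ 1 (deriv h) (Ioo t (τ + 1)) :=
      hS.deriv_of_isOpen isOpen_Ioo (by rw [show (2 : ℕ∞ω) = 1 + 1 from rfl])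
    exact (hS'.differentiableOn (by simp)).differentiableAt hmem
  -- the Riccati quotient `y = h / h'` and its derivative
  set y : ℝ → ℝ := fun τ => h τ / deriv h τ with hy
  have hyder : ∀ τ, t < τ → HasDerivAt y
      ((deriv h τ * deriv h τ - h τ * deriv (deriv h) τ) / deriv h τ ^ 2) τ := by
    intro τ hτ
    obtain ⟨hd₁, hd₂⟩ := hdiff τ hτ
    exact hd₁.hasDerivAt.div hd₂.hasDerivAt (hder τ hτ).1.ne
  have hyneg : ∀ τ, t < τ → y τ < 0 := fun τ hτ =>
    div_neg_of_pos_of_neg (hpos τ hτ) (hder τ hτ).1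
  have hyder_ge : ∀ τ, t < τ → 1 - ρ ≤ deriv y τ := by
    intro τ hτ
    rw [(hyder τ hτ).deriv]
    obtain ⟨hneg, hwc⟩ := hder τ hτ
    have hsq : 0 < deriv h τ ^ 2 := by rw [sq]; exact mul_pos_of_neg_of_neg hneg hneg
    rw [le_div_iff₀ hsq]
    nlinarith [hwc, hsq]
  -- mean value inequality on the convex set `(t, ∞)`
  have hcont : ContinuousOn y (Ioi t) := fun τ hτ =>
    (hyder τ hτ).continuousAt.continuousWithinAt
  have hdiffy : DifferentiableOn ℝ y (interior (Ioi t)) := by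
    rw [interior_Ioi]
    exact fun τ hτ => (hyder τ hτ).differentiableAt.differentiableWithinAt
  have hge : ∀ τ ∈ interior (Ioi t), 1 - ρ ≤ deriv y τ := by
    rw [interior_Ioi]
    exact fun τ hτ => hyder_ge τ hτ
  have hmvt := Convex.mul_sub_le_image_sub_of_le_deriv (convex_Ioi t) hcont hdiffy hge
  -- run from `s = t + 1` for parameter length `L = (1 - y s)/(1 - ρ)`
  set s : ℝ := t + 1 with hs
  have hst : t < s := by rw [hs]; exact lt_add_one t
  set L : ℝ := (1 - y s) / (1 - ρ) with hL
  have hLpos : 0 < L := div_pos (by linarith [hyneg s hst]) h1ρ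
  have hkey := hmvt s hst (s + L) (by show t < s + L; linarith) (by linarith)
  have hmul : (1 - ρ) * (s + L - s) = 1 - y s := by
    rw [add_sub_cancel_left, hL, mul_div_cancel₀ _ h1ρ.ne']
  rw [hmul] at hkey
  have := hyneg (s + L) (by linarith)
  linarith

/-- **Exit lemma for weighted null-concave crush functions** (first lemma of the crux idea card
`null-concave-crush` for `SettledCapture`, stmt-FinalStateConjecture-17328; the statement of
`Cruxes/SettledCapture/SketchIdeator2.lean` §3 with its binders moved behind the colon — the same
type — and the two idle instance binders `[T2Space X] [SecondCountableTopology X]` dropped).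
Let `B ⊆ 𝒟` be future-absorbing for normalised null rays from the data hypersurface (third
hypothesis) and let `f` be positive on `B` (second) and a weighted null-concave crush function along
ray segments in `B` (fourth: on every compact parameter segment inside `dom` whose image lies in
`B`, `h = f ∘ γ` is `C²`, with `h' < 0` and `h · h'' ≤ ρ · h'²` on the open segment, for one constant
`ρ < 1`, the first hypothesis). Then NO normalised null ray from `Σ` whose parameter domain is an
interval unbounded above (a future-complete ray) ever meets `B`: by
`false_of_pos_of_deriv_neg_of_weightedConcave` applied to `h = f ∘ γ` on `[t, ∞) ⊆ dom`.
(With `ρ ≤ 0` this is plain null-concavity of `f`; the weight admits parabolic arrivals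
`h ∼ (λ* − λ)²`, `ρ = 1/2`.) [folklore] -/
theorem exit_of_weightedConcave : ∀ {X : Type} [TopologicalSpace X] [ChartedSpace E3 X] [IsManifold (𝓡 3) ((⊤ : ℕ∞) : WithTop ℕ∞) X] [ConnectedSpace X] {D : InitialDataSet (𝓡 3) X} (𝒟 : VacuumCauchyDevelopment D) [𝒟.metric.HasLeviCivita] (B : Set 𝒟.carrier) (f : 𝒟.carrier → ℝ) (ρ : ℝ), ρ < 1 → (∀ x ∈ B, 0 < f x) → (∀ (p : X) (γ : ℝ → 𝒟.carrier) (dom : Set ℝ), 𝒟.metric.IsNormalisedNullRayFrom 𝒟.timeOrientation 𝒟.embed 𝒟.normal p γ dom → ∀ t₁ ∈ dom, ∀ t₂ ∈ dom, t₁ ≤ t₂ → γ t₁ ∈ B → γ t₂ ∈ B) → (∀ (p : X) (γ : ℝ → 𝒟.carrier) (dom : Set ℝ), 𝒟.metric.IsNormalisedNullRayFrom 𝒟.timeOrientation 𝒟.embed 𝒟.normal p γ dom → ∀ t₁ t₂ : ℝ, t₁ < t₂ → Set.Icc t₁ t₂ ⊆ dom → (∀ t ∈ Set.Icc t₁ t₂,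 γ t ∈ B) → ContDiffOn ℝ 2 (f ∘ γ) (Set.Icc t₁ t₂) ∧ ∀ t ∈ Set.Ioo t₁ t₂, deriv (f ∘ γ) t < 0 ∧ (f ∘ γ) t * deriv (deriv (f ∘ γ)) t ≤ ρ * deriv (f ∘ γ) t ^ 2) → ∀ (p : X) (γ : ℝ → 𝒟.carrier) (dom : Set ℝ), 𝒟.metric.IsNormalisedNullRayFrom 𝒟.timeOrientation 𝒟.embed 𝒟.normal p γ dom → dom.OrdConnected → ¬ BddAbove dom → ∀ t ∈ dom, γ t ∉ B := by
  intro X _ _ _ _ D 𝒟 _ B f ρ hρ hpos habs hcrush p γ dom hray hoc hunb t ht hB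
  -- `[t, ∞) ⊆ dom` and the ray stays in `B` from `t` on
  have hdom : ∀ τ, t ≤ τ → τ ∈ dom := by
    intro τ hτ
    obtain ⟨s, hs, hτs⟩ := not_bddAbove_iff.1 hunb τ
    exact hoc.out ht hs ⟨hτ, hτs.le⟩
  have hinB : ∀ τ, t ≤ τ → γ τ ∈ B := fun τ hτ =>
    habs p γ dom hray t ht τ (hdom τ hτ) hτ hB
  have hseg : ∀ T, t < T →
      ContDiffOn ℝ 2 (f ∘ γ) (Icc t T) ∧
        ∀ τ ∈ Ioo t T, deriv (f ∘ γ) τ < 0 ∧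
          (f ∘ γ) τ * deriv (deriv (f ∘ γ)) τ ≤ ρ * deriv (f ∘ γ) τ ^ 2 := fun T hT =>
    hcrush p γ dom hray t T hT (fun x hx => hdom x hx.1) fun x hx => hinB x hx.1
  exact false_of_pos_of_deriv_neg_of_weightedConcave (h := f ∘ γ) hρ
    (fun τ hτ => hpos _ (hinB τ hτ.le)) (fun T hT => (hseg T hT).1)
    fun τ hτ => (hseg (τ + 1) (by linarith)).2 τ ⟨hτ, lt_add_one τ⟩

end Summit.FinalStateConjecture.FinalStateConjecture.Theorems.BartnikGapSettling.SettledCapture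

end
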